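import Literature.Analysis.FunctionSpaces.TorusCalculusProofs
import Literature.Analysis.FunctionSpaces.TorusFourierCalculus
import Literature.Analysis.FunctionSpaces.TorusHeatSmoothing
import Summits.AnomalousDissipation.AnomalousDissipation.Theorems.SolenoidalFractalHomogenisationPermissibleFractalCarrierLayers
import HarnessLib

/-!
# The stream potential of a rescaled lattice shear layer (K1L `stub_tailL`, Eulerian half of the tail's potential)

Helper file for crux K1L `LagrangianRenormalisationStep` (stmt-AnomalousDissipation-24912), registered stub `stub_tailL`: the cell literature
lane's stream-form stability estimate (`Literature/Analysis/FluidPDE/PassiveVectorTensorStreamStability.lean`, ad-lit g21) compares two weak solutions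
along carriers `b`, `b'` with `(b − b')_a = Σ_i ∂_i ψ_{ia}` WEAKLY for an antisymmetric essentially bounded potential `ψ`, and the smallness ratio of
the K1L tail step is `‖ψ_{>j}‖_∞ / kbar_j` (cell STATUS 2026-08-28T08:1xZ: `≈ cellVisc(j+1)/c → 0`, whereas the velocity ratio diverges).  This file
supplies the potential of ONE rescaled Kolmogorov layer `x ↦ (1/n) • P.layer (n • x)` of a lattice phase `P = (m, ê, τ, φ)` in exactly that weak form:

  `Ψ_{ia}(x) = − Re(e_{nm}(x) e^{iφ}) · (m_i ê_a − ê_i m_a) / (4π² n² |m|³)`,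

antisymmetric, bounded by `1/(2π² n² |m|²)` (`abs_layerPotential_le`), smooth, with `Σ_i ∂_i Ψ_{ia} = ((1/n) • layer(n • x))_a` classically
(`sum_partialDeriv_layerPotential`: `∂_i Re(e_{nm} e^{iφ}) = −2πn m_i Im(e_{nm} e^{iφ})`, `Σ m_i² = |m|²`, `Σ m_i ê_i = 0`) and hence weakly against smooth
scalar tests (`integral_layer_mul_eq_neg_integral_potential`, integration by parts on `𝕋³`).  Linear combinations (slot envelopes, the shear rate `a_m`,
the cells `N_m`) are then immediate for the user.  No definitions (the potential is written out), no named facts, no sorry.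
Prover seat `ad-solenoidal-k2r-lowerlaw-p1` g5, 2026-08-28.
-/

set_option linter.dupNamespace false

noncomputable section

namespace Summit.AnomalousDissipation.AnomalousDissipation.Theorems.SolenoidalFractalHomogenisation.LagrangianCarrier

open Set MeasureTheory Function Complex
open scoped InnerProductSpace Real
open Literature.Analysis Literature.Analysis.FunctionSpaces Literature.Analysis.FunctionSpaces.Torus
open Literature.Analysis.FluidPDE Literature.Analysis.FluidPDE.LatticeShear
open Summit.AnomalousDissipation.AnomalousDissipation.Theorems.SolenoidalFractalHomogenisation.PermissibleCarrier
  (layer_nsmul_eq isSmooth_layer_nsmul)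

/-- The real read-out `z ↦ −Re(z e^{iφ}) · w / D` of a character as a real-linear map `ℂ →L[ℝ] ℝ`. [folklore] -/
theorem exists_clm_re_readout (φ w D : ℝ) :
    ∃ L : ℂ →L[ℝ] ℝ, ∀ z, L z = -((z * Complex.exp (φ * I)).re) * w / D := by
  refine ⟨(-(w / D)) • (Complex.reCLM.comp (ContinuousLinearMap.mulLeftRight ℝ ℂ 1 (Complex.exp (φ * I)))), fun z => ?_⟩
  simp [div_eq_mul_inv]
  ring

variable (P : LatticePhase) (n : ℕ)

/-- **The layer potential is antisymmetric.** [folklore] -/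
theorem layerPotential_antisymm (x : UnitAddTorus (Fin 3)) (i a : Fin 3) :
    -((UnitAddTorus.mFourier (fun j => P.m j * n) x * Complex.exp (P.φ * I)).re) *
        ((P.m i : ℝ) * P.e a - P.e i * (P.m a : ℝ)) / (4 * Real.pi ^ 2 * (n : ℝ) ^ 2 * ‖latticeVec P.m‖ ^ 3) =
    -(-((UnitAddTorus.mFourier (fun j => P.m j * n) x * Complex.exp (P.φ * I)).re) *
        ((P.m a : ℝ) * P.e i - P.e a * (P.m i : ℝ)) / (4 * Real.pi ^ 2 * (n : ℝ) ^ 2 * ‖latticeVec P.m‖ ^ 3)) := by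
  ring

/-- **Bound on the layer potential**: `|Ψ_{ia}| ≤ 1/(2π² n² |m|²)` (`|Re(e e^{iφ})| ≤ 1`, `|m_i ê_a − ê_i m_a| ≤ 2|m|`). [folklore] -/
theorem abs_layerPotential_le (hn : 0 < n) (x : UnitAddTorus (Fin 3)) (i a : Fin 3) :
    |-((UnitAddTorus.mFourier (fun j => P.m j * n) x * Complex.exp (P.φ * I)).re) *
        ((P.m i : ℝ) * P.e a - P.e i * (P.m a : ℝ)) / (4 * Real.pi ^ 2 * (n : ℝ) ^ 2 * ‖latticeVec P.m‖ ^ 3)| ≤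
      1 / (2 * Real.pi ^ 2 * (n : ℝ) ^ 2 * ‖latticeVec P.m‖ ^ 2) := by
  have hm : 1 ≤ ‖latticeVec P.m‖ := one_le_norm_latticeVec P.m_ne
  have hn' : (1 : ℝ) ≤ n := by exact_mod_cast hn
  have hD : 0 < 4 * Real.pi ^ 2 * (n : ℝ) ^ 2 * ‖latticeVec P.m‖ ^ 3 := by positivity
  -- `|Re(e e^{iφ})| ≤ 1`
  have hre : |(UnitAddTorus.mFourier (fun j => P.m j * n) x * Complex.exp (P.φ * I)).re| ≤ 1 := by
    refine (Complex.abs_re_le_norm _).trans ?_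
    rw [norm_mul, Complex.norm_exp_ofReal_mul_I, mul_one]
    simp only [UnitAddTorus.mFourier, ContinuousMap.coe_mk, norm_prod, fourier_apply, Circle.norm_coe,
      Finset.prod_const_one, le_refl]
  -- components are bounded by norms
  have hmi : |(P.m i : ℝ)| ≤ ‖latticeVec P.m‖ := abs_le_norm_latticeVec P.m i
  have hma : |(P.m a : ℝ)| ≤ ‖latticeVec P.m‖ := abs_le_norm_latticeVec P.m a
  have hei : |P.e i| ≤ 1 := by
    have h := PiLp.norm_apply_le P.e i
    rw [Real.norm_eq_abs, P.e_unit] at h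
    exact h
  have hea : |P.e a| ≤ 1 := by
    have h := PiLp.norm_apply_le P.e a
    rw [Real.norm_eq_abs, P.e_unit] at h
    exact h
  have hw : |(P.m i : ℝ) * P.e a - P.e i * (P.m a : ℝ)| ≤ 2 * ‖latticeVec P.m‖ := by
    calc |(P.m i : ℝ) * P.e a - P.e i * (P.m a : ℝ)| ≤ |(P.m i : ℝ) * P.e a| + |P.e i * (P.m a : ℝ)| := abs_sub _ _
      _ = |(P.m i : ℝ)| * |P.e a| + |P.e i| * |(P.m a : ℝ)| := by rw [abs_mul, abs_mul]
      _ ≤ ‖latticeVec P.m‖ * 1 + 1 * ‖latticeVec P.m‖ := by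
          gcongr
      _ = 2 * ‖latticeVec P.m‖ := by ring
  rw [abs_div, abs_mul, abs_neg, abs_of_pos hD, div_le_div_iff₀ hD (by positivity)]
  have h1 : |(UnitAddTorus.mFourier (fun j => P.m j * n) x * Complex.exp (P.φ * I)).re| *
      |(P.m i : ℝ) * P.e a - P.e i * (P.m a : ℝ)| ≤ 1 * (2 * ‖latticeVec P.m‖) :=
    mul_le_mul hre hw (abs_nonneg _) zero_le_one
  nlinarith [h1, Real.pi_pos, mul_pos (mul_pos (by positivity : (0:ℝ) < 2 * Real.pi ^ 2) (by positivity : (0:ℝ) < (n:ℝ) ^ 2))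
    (by positivity : (0:ℝ) < ‖latticeVec P.m‖ ^ 2)]

/-- `Re(2πi k Z · E) = −2πk · Im(Z E)`. [folklore] -/
theorem re_two_pi_I_mul (k : ℤ) (Z E : ℂ) :
    ((2 * (Real.pi : ℂ) * I * (k : ℂ) * Z) * E).re = -(2 * Real.pi * (k : ℝ)) * (Z * E).im := by
  have e : (2 * (Real.pi : ℂ) * I * (k : ℂ) * Z) * E = ((2 * Real.pi * (k : ℝ) : ℝ) : ℂ) * (I * (Z * E)) := by
    push_cast
    ring
  rw [e, Complex.re_ofReal_mul]
  simp [Complex.mul_re]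
  ring

/-- `Σ_i m_i² = |m|²` for a lattice vector. [folklore] -/
theorem sum_sq_eq_norm_latticeVec_sq (m : Fin 3 → ℤ) : ∑ i, ((m i : ℝ)) ^ 2 = ‖latticeVec m‖ ^ 2 := by
  rw [norm_latticeVec_sq, freqNormSq]

/-- `Σ_i m_i ê_i = 0` for a lattice phase (`ê ⊥ m`). [folklore] -/
theorem sum_m_mul_e_eq_zero : ∑ i, (P.m i : ℝ) * P.e i = 0 := by
  have h := P.e_perp
  rw [inner_latticeVec_right] at h
  simpa [mul_comm] using h

/-- **Partial derivatives of the layer potential**: `∂_k Ψ_{ia}(x) = 2π n m_k Im(e_{nm}(x)e^{iφ}) (m_i ê_a − ê_i m_a)/(4π²n²|m|³)`. [folklore] -/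
theorem partialDeriv_layerPotential (k i a : Fin 3) (x : UnitAddTorus (Fin 3)) :
    Torus.partialDeriv k (fun y : UnitAddTorus (Fin 3) =>
      -((UnitAddTorus.mFourier (fun j => P.m j * n) y * Complex.exp (P.φ * I)).re) *
        ((P.m i : ℝ) * P.e a - P.e i * (P.m a : ℝ)) / (4 * Real.pi ^ 2 * (n : ℝ) ^ 2 * ‖latticeVec P.m‖ ^ 3)) x =
      2 * Real.pi * ((P.m k * n : ℤ) : ℝ) * (UnitAddTorus.mFourier (fun j => P.m j * n) x * Complex.exp (P.φ * I)).im *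
        ((P.m i : ℝ) * P.e a - P.e i * (P.m a : ℝ)) / (4 * Real.pi ^ 2 * (n : ℝ) ^ 2 * ‖latticeVec P.m‖ ^ 3) := by
  obtain ⟨L, hL⟩ := exists_clm_re_readout P.φ ((P.m i : ℝ) * P.e a - P.e i * (P.m a : ℝ))
    (4 * Real.pi ^ 2 * (n : ℝ) ^ 2 * ‖latticeVec P.m‖ ^ 3)
  have hcomp : (fun y : UnitAddTorus (Fin 3) =>
      -((UnitAddTorus.mFourier (fun j => P.m j * n) y * Complex.exp (P.φ * I)).re) *
        ((P.m i : ℝ) * P.e a - P.e i * (P.m a : ℝ)) / (4 * Real.pi ^ 2 * (n : ℝ) ^ 2 * ‖latticeVec P.m‖ ^ 3)) =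
      L ∘ (⇑(UnitAddTorus.mFourier (fun j => P.m j * n)) : UnitAddTorus (Fin 3) → ℂ) := by
    funext y
    simp only [Function.comp_apply, hL]
  rw [hcomp, partialDeriv_clm_comp (isSmooth_mFourier _) L k x, partialDeriv_mFourier, hL, re_two_pi_I_mul]
  ring

/-- **The layer potential is a stream potential of the rescaled layer** (classical form):
`Σ_i ∂_i Ψ_{ia}(x) = ((1/n) • layer(n • x))_a`. [cite: MeshalkinSinai1961, pp. 1700–1705 (Kolmogorov shear layer as a stream function)] -/
theorem sum_partialDeriv_layerPotential (hn : 0 < n) (a : Fin 3) (x : UnitAddTorus (Fin 3)) :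
    ∑ i, Torus.partialDeriv i (fun y : UnitAddTorus (Fin 3) =>
      -((UnitAddTorus.mFourier (fun j => P.m j * n) y * Complex.exp (P.φ * I)).re) *
        ((P.m i : ℝ) * P.e a - P.e i * (P.m a : ℝ)) / (4 * Real.pi ^ 2 * (n : ℝ) ^ 2 * ‖latticeVec P.m‖ ^ 3)) x =
      (((1 / (n : ℝ)) • P.layer (n • x)) a) := by
  simp_rw [partialDeriv_layerPotential]
  rw [PiLp.smul_apply, layer_nsmul_eq, PiLp.smul_apply, smul_eq_mul, smul_eq_mul]
  set s : ℝ := (UnitAddTorus.mFourier (fun j => P.m j * n) x * Complex.exp (P.φ * I)).im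
  set N : ℝ := ‖latticeVec P.m‖ with hN
  have hN1 : 1 ≤ N := one_le_norm_latticeVec P.m_ne
  have hn' : (0 : ℝ) < n := by exact_mod_cast hn
  have h1 : ∑ i, ((P.m i : ℝ)) ^ 2 = N ^ 2 := sum_sq_eq_norm_latticeVec_sq P.m
  have h2 : ∑ i, (P.m i : ℝ) * P.e i = 0 := sum_m_mul_e_eq_zero P
  -- pull the common factors out of the sum
  have key : ∑ i, 2 * Real.pi * ((P.m i * n : ℤ) : ℝ) * s * ((P.m i : ℝ) * P.e a - P.e i * (P.m a : ℝ)) /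
        (4 * Real.pi ^ 2 * (n : ℝ) ^ 2 * N ^ 3) =
      (2 * Real.pi * n * s / (4 * Real.pi ^ 2 * (n : ℝ) ^ 2 * N ^ 3)) *
        ((∑ i, ((P.m i : ℝ)) ^ 2) * P.e a - (∑ i, (P.m i : ℝ) * P.e i) * (P.m a : ℝ)) := by
    rw [Finset.sum_mul, Finset.sum_mul, ← Finset.sum_sub_distrib, Finset.mul_sum]
    refine Finset.sum_congr rfl fun i _ => ?_
    push_cast
    ring
  rw [key, h1, h2]
  field_simp
  ring

/-- The layer potential components are smooth (real read-outs of a character). [folklore] -/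
theorem isSmooth_layerPotential (i a : Fin 3) :
    IsSmooth (fun y : UnitAddTorus (Fin 3) =>
      -((UnitAddTorus.mFourier (fun j => P.m j * n) y * Complex.exp (P.φ * I)).re) *
        ((P.m i : ℝ) * P.e a - P.e i * (P.m a : ℝ)) / (4 * Real.pi ^ 2 * (n : ℝ) ^ 2 * ‖latticeVec P.m‖ ^ 3)) := by
  obtain ⟨L, hL⟩ := exists_clm_re_readout P.φ ((P.m i : ℝ) * P.e a - P.e i * (P.m a : ℝ))
    (4 * Real.pi ^ 2 * (n : ℝ) ^ 2 * ‖latticeVec P.m‖ ^ 3)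
  have hcomp : (fun y : UnitAddTorus (Fin 3) =>
      -((UnitAddTorus.mFourier (fun j => P.m j * n) y * Complex.exp (P.φ * I)).re) *
        ((P.m i : ℝ) * P.e a - P.e i * (P.m a : ℝ)) / (4 * Real.pi ^ 2 * (n : ℝ) ^ 2 * ‖latticeVec P.m‖ ^ 3)) =
      L ∘ (⇑(UnitAddTorus.mFourier (fun j => P.m j * n)) : UnitAddTorus (Fin 3) → ℂ) := by
    funext y
    simp only [Function.comp_apply, hL]
  rw [hcomp]
  exact (isSmooth_mFourier _).comp_clm L

/-- **The layer potential in WEAK form** (the hypothesis shape `Hψ` of `PassiveVectorTensorStreamStability` at one time): for every smooth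
scalar test `φ` and component `a`, `∫ ((1/n) • layer(n • x))_a φ = −∫ Σ_i Ψ_{ia} ∂_i φ` (integration by parts on `𝕋³`, no boundary).
[cite: MeshalkinSinai1961, pp. 1700–1705 (Kolmogorov shear layer as a stream function)] -/
theorem integral_layer_mul_eq_neg_integral_potential (hn : 0 < n) {φ : UnitAddTorus (Fin 3) → ℝ} (hφ : IsSmooth φ) (a : Fin 3) :
    ∫ x, (((1 / (n : ℝ)) • P.layer (n • x)) a) * φ x =
      -∫ x, ∑ i, (-((UnitAddTorus.mFourier (fun j => P.m j * n) x * Complex.exp (P.φ * I)).re) *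
        ((P.m i : ℝ) * P.e a - P.e i * (P.m a : ℝ)) / (4 * Real.pi ^ 2 * (n : ℝ) ^ 2 * ‖latticeVec P.m‖ ^ 3)) *
          Torus.partialDeriv i φ x := by
  -- abbreviate the potential components
  set Ψ : Fin 3 → UnitAddTorus (Fin 3) → ℝ := fun i y =>
    -((UnitAddTorus.mFourier (fun j => P.m j * n) y * Complex.exp (P.φ * I)).re) *
      ((P.m i : ℝ) * P.e a - P.e i * (P.m a : ℝ)) / (4 * Real.pi ^ 2 * (n : ℝ) ^ 2 * ‖latticeVec P.m‖ ^ 3) with hΨ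
  have hΨs : ∀ i, IsSmooth (Ψ i) := fun i => isSmooth_layerPotential P n i a
  have hΨc : ∀ i, Continuous (Ψ i) := fun i => (hΨs i).continuous
  have hdΨc : ∀ i, Continuous (Torus.partialDeriv i (Ψ i)) := fun i => ((hΨs i).partialDeriv i).continuous
  have hφc : Continuous φ := hφ.continuous
  have hdφc : ∀ i, Continuous (Torus.partialDeriv i φ) := fun i => (hφ.partialDeriv i).continuous
  -- integrability of the continuous products
  have hI1 : ∀ i, Integrable (fun x => Ψ i x * Torus.partialDeriv i φ x) volume := fun i =>
    ((hΨc i).mul (hdφc i)).integrable_unitAddTorus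
  have hI2 : ∀ i, Integrable (fun x => Torus.partialDeriv i (Ψ i) x * φ x) volume := fun i =>
    ((hdΨc i).mul hφc).integrable_unitAddTorus
  -- one integration by parts per index
  have hibp : ∀ i, ∫ x, Ψ i x * Torus.partialDeriv i φ x = -∫ x, Torus.partialDeriv i (Ψ i) x * φ x := by
    intro i
    have hprod : ∀ x, Torus.partialDeriv i (fun y => Ψ i y * φ y) x =
        Ψ i x * Torus.partialDeriv i φ x + Torus.partialDeriv i (Ψ i) x * φ x := fun x =>
      partialDeriv_mul ((hΨs i).isContDiff (by exact_mod_cast le_top)) (hφ.isContDiff (by exact_mod_cast le_top)) i x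
    have hsm : IsSmooth (fun y => Ψ i y * φ y) := (hΨs i).mul hφ
    have h0 : ∫ x, Torus.partialDeriv i (fun y => Ψ i y * φ y) x = 0 := integral_partialDeriv_eq_zero_holds hsm i
    simp_rw [hprod] at h0
    rw [integral_add (hI1 i) (hI2 i)] at h0
    linarith
  -- sum over the indices
  have hsum : ∫ x, ∑ i, Ψ i x * Torus.partialDeriv i φ x = -∫ x, (∑ i, Torus.partialDeriv i (Ψ i) x) * φ x := by
    rw [integral_finsetSum _ fun i _ => hI1 i]
    simp_rw [hibp, Finset.sum_mul]
    rw [integral_finsetSum _ fun i _ => hI2 i, Finset.sum_neg_distrib]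
  rw [hsum, neg_neg]
  refine integral_congr_ae (ae_of_all _ fun x => ?_)
  dsimp only
  rw [show (∑ i, Torus.partialDeriv i (Ψ i) x) = (((1 / (n : ℝ)) • P.layer (n • x)) a) from
    sum_partialDeriv_layerPotential P n hn a x]

end Summit.AnomalousDissipation.AnomalousDissipation.Theorems.SolenoidalFractalHomogenisation.LagrangianCarrier

end
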